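/-
Copyright (c) 2026 the pub-hodgecm-mathlib formalisation cell (harness21).  Prover seat hodgecm-mathlib-K2E3-p14 (g9), Track B «K2-LIT» ∕ h413 =
`stmt-HodgeConjecture-24833`, line `K2_E3_EllipticInputs`, unit U4 «Keys», PART «U4Keys» socket :182 (U4f-χ₁-ram-one-pos), programme A_pos^{<}
(LINE-LEAD K2E3-plan (g5) L4 DEALS ROUND 2 2026-09-04T16:51:43Z, deal D174 = R90-C10-p01 (g2) OFFER (2); R0 census on the K2 bus 2026-09-04T22:04Z):
brick (i)^{<} «THE TWO-DEPTH (CONCAVE-EXPONENT) LEVEL GROUPS OF `U(σ, Φ₃)(K)` AND THEIR IWAHORI FACTORISATION» — the concave-function twin of ★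
`K2E3IwahoriLevelNFactorisation` (K2E3-p37 (g0), one depth `n`) and ★ `K2E3IwahoriFactorisationThree` (K2E3-p05 (g2), `n = 1`).  REPORT-FIRST 2026-09-04.
-/
import Literature.NumberTheory.Automorphic.UnitaryBruhatIwahoriThree      -- ★ (LH5-p05): `K₀` test `mem_glInt_subgroupOf_iff`, `coe_inv_apply_eq`, `not_forall_v_apply_lt_one_of_mem_glInt_subgroupOf`; brings ★ Iwasawa ∕ BigCell (`col_zero_isotropic`, `exists_coe_eq_lower`, `sum_rel_of_mem`)
import Literature.NumberTheory.Automorphic.CMPrincipalSeriesSpherical     -- ★ `val_proj_borelTriple` (the Levi projection reads off the diagonal)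
import Summits.HodgeConjecture.HodgeConjecture.Theorems.K2E3IwahoriLevelNFactorisation   -- ★ p861548 (K2E3-p37): the one-depth `J_n`, `mem_glInt_inf_conj_glInt_pow_iff` (§4 only)
import HarnessLib

/-!
# K2 ∕ E3 «EllipticInputs», unit U4 «Keys» — (U4f-χ₁-ram-one-pos), programme A_pos^{<} brick (i)^{<}: THE CONCAVE-EXPONENT («TWO-DEPTH») LEVEL GROUPS
# `J_e = {k ∈ U(σ, Φ₃)(K) : |kᵢⱼ| ≤ |ϖ|^{e i j}}` — existence for a concave exponent matrix `e`, the pivot, and the Iwahori factorisation `J_e = (J_e ∩ N̄)·(J_e ∩ T)·(J_e ∩ N)`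
# [BruhatTits1972 (4.4.3)–(4.4.4), §6.4; Casselman1995 Prop. 1.4.4; Roche1998 §2–§3; Tits1979 §3.7]

Cell hodgecm-mathlib, Track B «K2-LIT», crux item H413 = stmt-HodgeConjecture-24833 (route `HCCMUnconditional`, no route verbs); serves BY NAME the OPEN tier-0 leaf
`…K2E3EllipticInputs.U4Keys.sig_K2E3KeysThmTwoContractingRamifiedCharOnePosDepth` (U4Keys :182; Keys §7 Thm (2) for `χ₁` of POSITIVE depth) in the regime A_pos^{<}
(`c_F := cond(χ₁|_{F^×}) < n := cond χ₁`, K2E3-p37 (g0) memo `K2/K2E3-p37/g0/CENSUS-U4f-PosDepth.K2E3-p37-g0.md` §9).  Author K2E3-p14 (g9).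
`--supports stmt-HodgeConjecture-24833 --as helper`; THEOREMS ONLY (no `def`, no `instance`, no `notation`, no named fact, no `sorry`); MODEL level (`U(σ, Φ₃)(K)`, `K` with
`Valued K ℤᵐ⁰`, ANY isometric involution `σ`, a uniformiser `ϖ`; letters of ★ `UnitaryIwahoriSubgroupThree`: `hσ hvσ hvϖ; hJ`).  NOT THE PAYER of :182.

THE POINT.  At positive depth with `c_F < n`, design D-I cannot run on the uniform level-`n` Iwahori `J_n` (all strictly-lower entries in `𝔭ⁿ`): some intermediate cells are
`θ`-relevant (memo §9); Roche's type group `J_χ` is ASYMMETRIC — a Bruhat–Tits group `U_f⁻·T(𝒪)·U_f⁺` for a CONCAVE `f` on the roots `±α, ±2α` of `U(2,1)`, with different depths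
on the short-root coordinates (`x`: entries `(1,0),(2,1)`; `y`: `(0,1),(1,2)`) and the long-root ones (`z`: `(2,0)`; `b`: `(0,2)`).  This file types ALL such groups at once in matrix
currency: an EXPONENT MATRIX `e : Fin 3 → Fin 3 → ℕ` and the test `TEST_e(k) :≡ ∀ i j, |kᵢⱼ| ≤ |ϖ|^{e i j}`.  For CONCAVE `e` — `e i i = 0`, TRIANGLE `e i j ≤ e i m + e m j`,
ANTI-TRANSPOSE symmetry `e (rev j) (rev i) = e i j` (forced by `(k⁻¹)ᵢⱼ = σ(k_{rev j, rev i})`) — the test cuts out a SUBGROUP (§1: ultrametric inequality; ★ `coe_inv_apply_eq`).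
For the TWO-DEPTH shape `e = ![![0, r, s], ![r', 0, r], ![s', r', 0]]` the triangle inequalities ARE Roche's concavity conditions `s ≤ 2r`, `s' ≤ 2r'`, `r ≤ s + r'`, `r' ≤ s' + r`;
★ p861548's `J_n` is `(r, s, r', s') = (0, 0, n, n)` (§4).  The group is carried HYPOTHESIS-FIRST as letters `(Jg : Subgroup ↥U) (hJg : ∀ k, k ∈ Jg ↔ TEST_e k)` (as ★
`K2E3IwahoriLevelNLettersCM`'s `Jn hJn`), and §2–§3 prove for EVERY `e` with `e i i = 0`, the symmetry and `1 ≤ e 1 0`, `1 ≤ e 2 0` (N̄-side in `𝔭`): `Jg ≤ K₀`; the pivot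
`|g₀₀| = 1`; `g = n̄·b`, `n̄ = ū(-σg₁₀∕σg₀₀, g₂₀∕g₀₀) ∈ Jg` BY THE TEST; `g = n̄·m·n`, `m = diag(bᵢᵢ)` (★ `val_proj_borelTriple`); and the set identity `Jg = (Jg ∩ N̄)(Jg ∩ T)(Jg ∩ N)`
— the `factorization` field of ★ `ParabolicTriple.IwahoriDatum`.  Concavity is consumed once, by the EXISTENCE of `Jg` (§1); §2–§3 need none of it.
* §1 `forall_v_le_one_of_test`, **`exists_subgroup_forall_mem_iff`** (concave `e` ⇒ `∃ Jg, ∀ k, k ∈ Jg ↔ TEST_e k`), `twoDepth_triangle`, `twoDepth_symm`,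
  **`exists_subgroup_forall_mem_iff_twoDepth`**, `test_twoDepth_iff` (the two-depth test as seven clauses).
* §2 `le_glInt_subgroupOf` (`Jg ≤ K₀`), `v_apply_zero_zero_eq_one_of_mem` (the pivot), `mem_of_diagonal` (integral diagonal unitaries lie in `Jg`).
* §3 `exists_lowerU_mul_borel_of_mem` (`g = n̄ b`), **`exists_nbar_mul_torus_mul_unipotent_of_mem`** (`g = n̄ m n`), **`coe_eq_mul`** (`Jg = (Jg ∩ N̄)(Jg ∩ T)(Jg ∩ N)`).
* §4 `mem_levelN_iff_test` (★ p861548's `J_n = K₀ ⊓ g_nK₀g_n⁻¹` satisfies `hJg` with `e = ![![0,0,0],![n,0,0],![n,n,0]]`).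
HONEST LABEL: HC_CM is proved only modulo the 7 printed citations (2 remaining named inputs: hLiu418 = stmt-HodgeConjecture-24832, h413 = stmt-HodgeConjecture-24833)
until rung 0 closes; count-neutral (group theory; no printed citation is discharged; the leaf :182 stays OPEN).

## References
* [BruhatTits1972] F. Bruhat, J. Tits, *Groupes réductifs sur un corps local I*, Publ. Math. IHÉS 41 (1972), (4.4.3)–(4.4.4) and §6.4 (concave functions `f`, the groups `U_f`, `P_f = U_f⁻ H U_f⁺`).
* [Casselman1995] W. Casselman, *Introduction to the theory of admissible representations of `p`-adic reductive groups* (1995), Prop. 1.4.4 (Iwahori factorisation).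
* [Roche1998] A. Roche, *Types and Hecke algebras for principal series representations of split reductive p-adic groups*, Ann. Sci. ÉNS (4) 31 (1998), §2–§3 (`f_χ`, `J_χ = ⟨T₀, U_{α, f_χ(α)}⟩`, Lemma 3.2).
* [Tits1979] J. Tits, *Reductive groups over local fields*, Proc. Symp. Pure Math. 33.1 (1979), §3.7.
* [Rogawski1990] J. D. Rogawski, *Automorphic Representations of Unitary Groups in Three Variables* (1990), §1.9–§1.10 pp. 8–9.
-/

set_option autoImplicit false
-- the mandated namespace repeats the single-problem summit's segment (`HodgeConjecture.HodgeConjecture`)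
set_option linter.dupNamespace false

noncomputable section

open Matrix Literature.NumberTheory.Automorphic Literature.NumberTheory.Automorphic.UnitaryGroup
open scoped Matrix MatrixGroups WithZero Pointwise

namespace Summit.HodgeConjecture.HodgeConjecture.Cruxes.H413.K2E3IwahoriTwoDepthFactorisation

variable {K : Type*} [Field K] [Valued K ℤᵐ⁰] [ValuativeRel K] [(Valued.v : Valuation K ℤᵐ⁰).Compatible]
  (σ : K →+* K) {ϖ : K} {J : Matrix (Fin 3) (Fin 3) K} (hJ : J = (StdForm.antidiagonal 3).over K)
  (hσ : ∀ a, σ (σ a) = a) (hvσ : ∀ a, Valued.v (σ a) = Valued.v a) (hvϖ : Valued.v ϖ = WithZero.exp (-1 : ℤ))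
  (e : Fin 3 → Fin 3 → ℕ)

/-! ## §1 The concave-exponent level group exists: `TEST_e` cuts out a subgroup of `U(σ, Φ₃)` -/

omit [ValuativeRel K] [(Valued.v : Valuation K ℤᵐ⁰).Compatible] in
include hvϖ in
/-- `|ϖ| ≤ 1` for a uniformiser. [cite: Tits1979, §3.3.1] -/
theorem v_uniformiser_le_one : Valued.v ϖ ≤ 1 := by
  rw [hvϖ, ← WithZero.exp_zero, WithZero.exp_le_exp]; norm_num

omit [ValuativeRel K] [(Valued.v : Valuation K ℤᵐ⁰).Compatible] in
include hvϖ in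
/-- An element passing `TEST_e` has integral entries (`|ϖ|^{e i j} ≤ 1`). [cite: BruhatTits1972, §6.4] [cite: Tits1979, §3.7] -/
theorem forall_v_le_one_of_test {k : ↥(unitaryGroupOfForm σ J)}
    (hk : ∀ i j, Valued.v (((k : GL (Fin 3) K) : Matrix (Fin 3) (Fin 3) K) i j) ≤ Valued.v ϖ ^ e i j) (i j : Fin 3) :
    Valued.v (((k : GL (Fin 3) K) : Matrix (Fin 3) (Fin 3) K) i j) ≤ 1 :=
  (hk i j).trans (pow_le_one' (v_uniformiser_le_one hvϖ) _)

omit [ValuativeRel K] [(Valued.v : Valuation K ℤᵐ⁰).Compatible] in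
include hJ hvσ hvϖ in
/-- **THE CONCAVE-EXPONENT LEVEL GROUP EXISTS.**  For an exponent matrix `e` with `e i i = 0`, the TRIANGLE inequality `e i j ≤ e i m + e m j`, and the ANTI-TRANSPOSE symmetry
`e (rev j) (rev i) = e i j`, the set `{k ∈ U(σ, Φ₃) : ∀ i j, |kᵢⱼ| ≤ |ϖ|^{e i j}}` is a SUBGROUP: `1` passes (`e i i = 0`); a product passes by `(kk′)ᵢⱼ = ∑ₘ kᵢₘ k′ₘⱼ`, the
ultrametric inequality and `|ϖ|^{e i m + e m j} ≤ |ϖ|^{e i j}`; an inverse passes by `(k⁻¹)ᵢⱼ = σ(k_{rev j, rev i})` (★ `coe_inv_apply_eq`) and the symmetry.  This is Bruhat–Tits'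
`P_f = U_f⁻ · H · U_f⁺` for a concave `f`, Roche's `J_χ` included; stated as an EXISTENCE so that consumers carry the group hypothesis-first as `(Jg, hJg)`.
[cite: BruhatTits1972, §6.4, (4.4.3)–(4.4.4)] [cite: Roche1998, §3, Lemma 3.2] [cite: Tits1979, §3.7] -/
theorem exists_subgroup_forall_mem_iff (he0 : ∀ i, e i i = 0) (htri : ∀ i m j, e i j ≤ e i m + e m j)
    (hsym : ∀ i j, e (Fin.rev j) (Fin.rev i) = e i j) :
    ∃ Jg : Subgroup ↥(unitaryGroupOfForm σ J),
      ∀ k, k ∈ Jg ↔ ∀ i j, Valued.v (((k : GL (Fin 3) K) : Matrix (Fin 3) (Fin 3) K) i j) ≤ Valued.v ϖ ^ e i j := by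
  have hvϖ1 : Valued.v ϖ ≤ 1 := v_uniformiser_le_one hvϖ
  refine ⟨{ carrier := {k | ∀ i j, Valued.v (((k : GL (Fin 3) K) : Matrix (Fin 3) (Fin 3) K) i j) ≤ Valued.v ϖ ^ e i j}
            mul_mem' := ?_, one_mem' := ?_, inv_mem' := ?_ }, fun k => Iff.rfl⟩
  · intro a b ha hb
    simp only [Set.mem_setOf_eq] at ha hb ⊢
    intro i j
    rw [Subgroup.coe_mul, Units.val_mul, Matrix.mul_apply]
    refine Valuation.map_sum_le _ fun m _ => ?_
    rw [map_mul]
    calc Valued.v (((a : GL (Fin 3) K) : Matrix (Fin 3) (Fin 3) K) i m) * Valued.v (((b : GL (Fin 3) K) : Matrix (Fin 3) (Fin 3) K) m j)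
        ≤ Valued.v ϖ ^ e i m * Valued.v ϖ ^ e m j := mul_le_mul' (ha i m) (hb m j)
      _ = Valued.v ϖ ^ (e i m + e m j) := (pow_add _ _ _).symm
      _ ≤ Valued.v ϖ ^ e i j := pow_le_pow_right_of_le_one' hvϖ1 (htri i m j)
  · simp only [Set.mem_setOf_eq]
    intro i j
    rw [Subgroup.coe_one, Units.val_one, Matrix.one_apply]
    split_ifs with hij
    · subst hij; rw [map_one, he0, pow_zero]
    · rw [map_zero]; exact zero_le
  · intro k hk
    simp only [Set.mem_setOf_eq] at hk ⊢
    intro i j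
    rw [coe_inv_apply_eq σ hJ k i j, hvσ, ← hsym i j]
    exact hk (Fin.rev j) (Fin.rev i)

/-- **The two-depth exponent matrix is concave iff Roche's ∕ Bruhat–Tits' inequalities hold** (triangle part): for `e = ![![0, r, s], ![r', 0, r], ![s', r', 0]]`
(N-side depths `r` on `(0,1),(1,2)` and `s` on `(0,2)`; N̄-side depths `r'` on `(1,0),(2,1)` and `s'` on `(2,0)`), the six non-trivial triangle inequalities are exactly
`s ≤ 2r` (`e₀₂ ≤ e₀₁ + e₁₂`), `s' ≤ 2r'` (`e₂₀ ≤ e₂₁ + e₁₀`), `r ≤ s + r'` (`e₀₁ ≤ e₀₂ + e₂₁`, `e₁₂ ≤ e₁₀ + e₀₂`), `r' ≤ s' + r` (`e₁₀ ≤ e₁₂ + e₂₀`, `e₂₁ ≤ e₂₀ + e₀₁`)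
— the concavity `f(a + b) ≤ f(a) + f(b)` of `f(α) = r, f(2α) = s, f(-α) = r', f(-2α) = s'` on the roots `±α, ±2α` of `U(2,1)`. [cite: BruhatTits1972, §6.4] [cite: Roche1998, §3] -/
theorem twoDepth_triangle {r s r' s' : ℕ} (hs : s ≤ 2 * r) (hs' : s' ≤ 2 * r') (hr : r ≤ s + r') (hr' : r' ≤ s' + r)
    (i m j : Fin 3) :
    (![![0, r, s], ![r', 0, r], ![s', r', 0]] : Fin 3 → Fin 3 → ℕ) i j ≤
      (![![0, r, s], ![r', 0, r], ![s', r', 0]] : Fin 3 → Fin 3 → ℕ) i m + (![![0, r, s], ![r', 0, r], ![s', r', 0]] : Fin 3 → Fin 3 → ℕ) m j := by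
  fin_cases i <;> fin_cases m <;> fin_cases j <;> simp <;> omega

/-- The two-depth exponent matrix is ANTI-TRANSPOSE symmetric (`(0,1) ↔ (1,2)`, `(1,0) ↔ (2,1)`, `(0,2)`, `(2,0)` and the diagonal fixed). [cite: BruhatTits1972, §6.4] -/
theorem twoDepth_symm (r s r' s' : ℕ) (i j : Fin 3) :
    (![![0, r, s], ![r', 0, r], ![s', r', 0]] : Fin 3 → Fin 3 → ℕ) (Fin.rev j) (Fin.rev i) =
      (![![0, r, s], ![r', 0, r], ![s', r', 0]] : Fin 3 → Fin 3 → ℕ) i j := by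
  fin_cases i <;> fin_cases j <;> rfl

omit [ValuativeRel K] [(Valued.v : Valuation K ℤᵐ⁰).Compatible] in
include hJ hvσ hvϖ in
/-- **THE TWO-DEPTH LEVEL GROUP `J_{r,s;r',s'}` EXISTS** under Roche's concavity conditions `s ≤ 2r`, `s' ≤ 2r'`, `r ≤ s + r'`, `r' ≤ s' + r`: a subgroup `Jg ≤ U(σ, Φ₃)` with
`k ∈ Jg ↔` all entries integral-to-depth `e = ![![0, r, s], ![r', 0, r], ![s', r', 0]]`, i.e. `y`-entries `(0,1),(1,2) ∈ 𝔭ʳ`, `b`-entry `(0,2) ∈ 𝔭ˢ`, `x`-entries `(1,0),(2,1) ∈ 𝔭^{r'}`,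
`z`-entry `(2,0) ∈ 𝔭^{s'}`, diagonal integral.  Roche's `J_χ` for `U(2,1)` is `(r, s, r', s') = (f_χ(α), f_χ(2α), f_χ(-α), f_χ(-2α))`.
[cite: Roche1998, §3, Lemma 3.2] [cite: BruhatTits1972, §6.4] -/
theorem exists_subgroup_forall_mem_iff_twoDepth {r s r' s' : ℕ} (hs : s ≤ 2 * r) (hs' : s' ≤ 2 * r') (hr : r ≤ s + r') (hr' : r' ≤ s' + r) :
    ∃ Jg : Subgroup ↥(unitaryGroupOfForm σ J),
      ∀ k, k ∈ Jg ↔ ∀ i j, Valued.v (((k : GL (Fin 3) K) : Matrix (Fin 3) (Fin 3) K) i j) ≤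
        Valued.v ϖ ^ (![![0, r, s], ![r', 0, r], ![s', r', 0]] : Fin 3 → Fin 3 → ℕ) i j :=
  exists_subgroup_forall_mem_iff σ hJ hvσ hvϖ _ (fun i => by fin_cases i <;> rfl) (twoDepth_triangle hs hs' hr hr') (twoDepth_symm r s r' s')

omit [ValuativeRel K] [(Valued.v : Valuation K ℤᵐ⁰).Compatible] in
/-- **The two-depth test as seven clauses**: `TEST_e(k)` for `e = ![![0, r, s], ![r', 0, r], ![s', r', 0]]` iff `k` is integral and `|k₀₁|, |k₁₂| ≤ |ϖ|ʳ`, `|k₀₂| ≤ |ϖ|ˢ`,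
`|k₁₀|, |k₂₁| ≤ |ϖ|^{r'}`, `|k₂₀| ≤ |ϖ|^{s'}` (the shape in which ★ `mem_glInt_inf_conj_glInt_pow_iff` states the one-depth test). [cite: Roche1998, §3] [cite: BruhatTits1972, (4.4.3)] -/
theorem test_twoDepth_iff (hvϖ1 : Valued.v ϖ ≤ 1) (r s r' s' : ℕ) (k : ↥(unitaryGroupOfForm σ J)) :
    (∀ i j, Valued.v (((k : GL (Fin 3) K) : Matrix (Fin 3) (Fin 3) K) i j) ≤
        Valued.v ϖ ^ (![![0, r, s], ![r', 0, r], ![s', r', 0]] : Fin 3 → Fin 3 → ℕ) i j) ↔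
      (∀ i j, Valued.v (((k : GL (Fin 3) K) : Matrix (Fin 3) (Fin 3) K) i j) ≤ 1) ∧
        Valued.v (((k : GL (Fin 3) K) : Matrix (Fin 3) (Fin 3) K) 0 1) ≤ Valued.v ϖ ^ r ∧
        Valued.v (((k : GL (Fin 3) K) : Matrix (Fin 3) (Fin 3) K) 1 2) ≤ Valued.v ϖ ^ r ∧
        Valued.v (((k : GL (Fin 3) K) : Matrix (Fin 3) (Fin 3) K) 0 2) ≤ Valued.v ϖ ^ s ∧
        Valued.v (((k : GL (Fin 3) K) : Matrix (Fin 3) (Fin 3) K) 1 0) ≤ Valued.v ϖ ^ r' ∧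
        Valued.v (((k : GL (Fin 3) K) : Matrix (Fin 3) (Fin 3) K) 2 1) ≤ Valued.v ϖ ^ r' ∧
        Valued.v (((k : GL (Fin 3) K) : Matrix (Fin 3) (Fin 3) K) 2 0) ≤ Valued.v ϖ ^ s' := by
  constructor
  · intro h
    refine ⟨fun i j => (h i j).trans (pow_le_one' hvϖ1 _), ?_, ?_, ?_, ?_, ?_, ?_⟩
    · simpa using h 0 1
    · simpa using h 1 2
    · simpa using h 0 2
    · simpa using h 1 0
    · simpa using h 2 1
    · simpa using h 2 0
  · rintro ⟨hint, h01, h12, h02, h10, h21, h20⟩ i j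
    fin_cases i <;> fin_cases j
    all_goals
      simp only [Fin.zero_eta, Fin.mk_one, Fin.reduceFinMk, Fin.isValue, Matrix.cons_val_zero, Matrix.cons_val_one, Matrix.cons_val,
        pow_zero]
    all_goals first | exact hint _ _ | assumption

/-! ## §2 Over the letters `(Jg, hJg)`: `Jg ≤ K₀`, the pivot, diagonal elements -/

section Letters

variable (Jg : Subgroup ↥(unitaryGroupOfForm σ J))
  (hJg : ∀ k, k ∈ Jg ↔ ∀ i j, Valued.v (((k : GL (Fin 3) K) : Matrix (Fin 3) (Fin 3) K) i j) ≤ Valued.v ϖ ^ e i j)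

include hJ hvσ hvϖ hJg in
/-- **`Jg ≤ K₀`**: every concave-exponent level group consists of integral unitaries (★ `mem_glInt_subgroupOf_iff`). [cite: BruhatTits1972, §6.4] [cite: Tits1979, §3.7] -/
theorem le_glInt_subgroupOf : Jg ≤ (glInt 3 K).subgroupOf (unitaryGroupOfForm σ J) := fun k hk =>
  (mem_glInt_subgroupOf_iff σ hJ hvσ k).2 (forall_v_le_one_of_test σ hvϖ e ((hJg k).1 hk))

include hJ hvσ hvϖ hJg in
/-- **The `(0,0)` entry of an element of `Jg` is a unit** as soon as the N̄-side lies in `𝔭` (`1 ≤ e 1 0`, `1 ≤ e 2 0`): `g₁₀, g₂₀ ∈ 𝔭`; the last row of `g⁻¹ ∈ K₀` is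
`(σg₂₀, σg₁₀, σg₀₀)` (★ `coe_inv_apply_eq`) and no row of an element of `K₀` lies in `𝔭³` (★ `not_forall_v_apply_lt_one_of_mem_glInt_subgroupOf`).
[cite: BruhatTits1972, (4.4.4)] [cite: Tits1979, §3.7] -/
theorem v_apply_zero_zero_eq_one_of_mem (h10 : 1 ≤ e 1 0) (h20 : 1 ≤ e 2 0) {g : ↥(unitaryGroupOfForm σ J)} (hg : g ∈ Jg) :
    Valued.v (((g : GL (Fin 3) K) : Matrix (Fin 3) (Fin 3) K) 0 0) = 1 := by
  have hvϖ1 : Valued.v ϖ < 1 := by rw [hvϖ, ← WithZero.exp_zero, WithZero.exp_lt_exp]; norm_num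
  have ht := (hJg g).1 hg
  have hlt10 : Valued.v (((g : GL (Fin 3) K) : Matrix (Fin 3) (Fin 3) K) 1 0) < 1 :=
    (ht 1 0).trans_lt (pow_lt_one' hvϖ1 (Nat.one_le_iff_ne_zero.1 h10))
  have hlt20 : Valued.v (((g : GL (Fin 3) K) : Matrix (Fin 3) (Fin 3) K) 2 0) < 1 :=
    (ht 2 0).trans_lt (pow_lt_one' hvϖ1 (Nat.one_le_iff_ne_zero.1 h20))
  refine le_antisymm (forall_v_le_one_of_test σ hvϖ e ht 0 0) ?_
  by_contra h00
  rw [not_le] at h00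
  have hK0 : g⁻¹ ∈ (glInt 3 K).subgroupOf (unitaryGroupOfForm σ J) :=
    Subgroup.inv_mem _ (le_glInt_subgroupOf σ hJ hvσ hvϖ e Jg hJg hg)
  refine not_forall_v_apply_lt_one_of_mem_glInt_subgroupOf σ hJ hvσ hK0 2 fun j => ?_
  rw [coe_inv_apply_eq σ hJ g 2 j, hvσ]
  fin_cases j
  · exact hlt20
  · exact hlt10
  · exact h00

include hJ hvσ hJg in
/-- **Integral DIAGONAL unitaries lie in every `Jg`** (`e i i = 0`; the off-diagonal entries vanish) — the Levi factor `Jg ∩ T = T(𝒪)` is depth-independent.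
[cite: BruhatTits1972, (4.4.4)] [cite: Casselman1995, Prop. 1.4.4] -/
theorem mem_of_diagonal (he0 : ∀ i, e i i = 0) {m : ↥(unitaryGroupOfForm σ J)} (hm : m ∈ (glInt 3 K).subgroupOf (unitaryGroupOfForm σ J))
    {d : Fin 3 → K} (hd : ((m : GL (Fin 3) K) : Matrix (Fin 3) (Fin 3) K) = Matrix.diagonal d) : m ∈ Jg := by
  rw [hJg]
  intro i j
  by_cases hij : i = j
  · subst hij
    rw [he0, pow_zero]
    exact (mem_glInt_subgroupOf_iff σ hJ hvσ m).1 hm i i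
  · rw [hd, Matrix.diagonal_apply_ne _ hij, map_zero]; exact zero_le

/-! ## §3 `g = n̄ · b`, `g = n̄ · m · n` and the set identity `Jg = (Jg ∩ N̄)(Jg ∩ T)(Jg ∩ N)` -/

include hJ hσ hvσ hvϖ hJg in
-- adapted from ★ `K2E3IwahoriLevelNFactorisation.exists_lowerU_mul_borel_of_mem_inf_pow` (K2E3-p37 (g0)): the level test is now the letter `hJg`
/-- **`g = n̄ · b`** for `g ∈ Jg` (`e i i = 0`, anti-transpose symmetric `e`, N̄-side in `𝔭`): `n̄ = ū(p, q) ∈ Jg ∩ w N w` with `p = -σg₁₀∕σg₀₀`, `q = g₂₀∕g₀₀` (unitary by the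
isotropy of the first column of `g`; `|p| ≤ |ϖ|^{e 1 0} = |ϖ|^{e 2 1}`, `|q| ≤ |ϖ|^{e 2 0}`, so `n̄ ∈ Jg` BY THE TEST), and `b = n̄⁻¹ g ∈ Jg` is upper triangular (`b₁₀ = b₂₀ = 0` by
construction, `b₂₁ = 0` by the `(0,1)` Hermitian relation ★ `sum_rel_of_mem`).
[cite: BruhatTits1972, (4.4.3)] [cite: Casselman1995, Prop. 1.4.4] [cite: Roche1998, §2–§3] [cite: Rogawski1990, §1.10 p. 9] -/
theorem exists_lowerU_mul_borel_of_mem (he0 : ∀ i, e i i = 0) (hsym : ∀ i j, e (Fin.rev j) (Fin.rev i) = e i j)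
    (h10 : 1 ≤ e 1 0) (h20 : 1 ≤ e 2 0) {g : ↥(unitaryGroupOfForm σ J)} (hg : g ∈ Jg) :
    ∃ nb b : ↥(unitaryGroupOfForm σ J),
      nb ∈ Jg ∧ nb ∈ ((borelTriple σ J hJ).N).map (MulAut.conj (weylLongU σ hJ)).toMonoidHom ∧
      b ∈ Jg ∧ b ∈ borelU σ J ∧ g = nb * b := by
  have hvϖ1 : Valued.v ϖ ≤ 1 := v_uniformiser_le_one hvϖ
  have ht := (hJg g).1 hg
  have hint : ∀ i j, Valued.v (((g : GL (Fin 3) K) : Matrix (Fin 3) (Fin 3) K) i j) ≤ 1 := forall_v_le_one_of_test σ hvϖ e ht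
  have h00 := v_apply_zero_zero_eq_one_of_mem σ hJ hvσ hvϖ e Jg hJg h10 h20 hg
  have he21 : e 2 1 = e 1 0 := hsym 1 0
  -- names for the first column
  set a : K := ((g : GL (Fin 3) K) : Matrix (Fin 3) (Fin 3) K) 0 0 with ha
  set b₁ : K := ((g : GL (Fin 3) K) : Matrix (Fin 3) (Fin 3) K) 1 0 with hb₁
  set c : K := ((g : GL (Fin 3) K) : Matrix (Fin 3) (Fin 3) K) 2 0 with hc
  have ha0 : a ≠ 0 := fun h => by rw [h, map_zero] at h00; exact zero_ne_one h00
  have hσa0 : σ a ≠ 0 := (map_ne_zero σ).2 ha0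
  have hiso : σ a * c + σ b₁ * b₁ + σ c * a = 0 := col_zero_isotropic σ hJ g
  -- the lower unitriangular `n̄ = ū(p, q)`
  set p : K := -(σ b₁ / σ a) with hp
  set q : K := c / a with hq
  have hσp : σ p = -(b₁ / a) := by rw [hp, map_neg, map_div₀, hσ, hσ]
  have hσq : σ q = σ c / σ a := by rw [hq, map_div₀]
  have hrel : q + σ q + p * σ p = 0 := by
    rw [hσq, hσp, hp, hq]
    field_simp
    linear_combination hiso
  obtain ⟨nb, hnb⟩ := exists_coe_eq_lower σ hJ hσ hrel
  have hvp : Valued.v p ≤ Valued.v ϖ ^ e 1 0 := by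
    rw [hp, Valuation.map_neg, map_div₀, hvσ, hvσ, h00, div_one]; exact ht 1 0
  have hvp' : Valued.v p ≤ Valued.v ϖ ^ e 2 1 := by rw [he21]; exact hvp
  have hvq : Valued.v q ≤ Valued.v ϖ ^ e 2 0 := by
    rw [hq, map_div₀, h00, div_one]; exact ht 2 0
  have hvσp : Valued.v (-σ p) ≤ Valued.v ϖ ^ e 1 0 := by rw [Valuation.map_neg, hvσ]; exact hvp
  -- the entries of `n̄`
  have e00 : ((nb : GL (Fin 3) K) : Matrix (Fin 3) (Fin 3) K) 0 0 = 1 := by rw [hnb]; rfl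
  have e11 : ((nb : GL (Fin 3) K) : Matrix (Fin 3) (Fin 3) K) 1 1 = 1 := by rw [hnb]; rfl
  have e22 : ((nb : GL (Fin 3) K) : Matrix (Fin 3) (Fin 3) K) 2 2 = 1 := by rw [hnb]; rfl
  have e01 : ((nb : GL (Fin 3) K) : Matrix (Fin 3) (Fin 3) K) 0 1 = 0 := by rw [hnb]; rfl
  have e02 : ((nb : GL (Fin 3) K) : Matrix (Fin 3) (Fin 3) K) 0 2 = 0 := by rw [hnb]; rfl
  have e12 : ((nb : GL (Fin 3) K) : Matrix (Fin 3) (Fin 3) K) 1 2 = 0 := by rw [hnb]; rfl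
  have e10 : ((nb : GL (Fin 3) K) : Matrix (Fin 3) (Fin 3) K) 1 0 = -σ p := by rw [hnb]; rfl
  have e20 : ((nb : GL (Fin 3) K) : Matrix (Fin 3) (Fin 3) K) 2 0 = q := by rw [hnb]; rfl
  have e21 : ((nb : GL (Fin 3) K) : Matrix (Fin 3) (Fin 3) K) 2 1 = p := by rw [hnb]; rfl
  -- `n̄ ∈ Jg` BY THE TEST
  have hnbI : nb ∈ Jg := by
    rw [hJg, hnb]
    intro i j
    fin_cases i <;> fin_cases j <;> simp [he0, he21, hvσ, hvp, hvq]
  -- `n̄ ∈ N̄ = w N w`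
  have hlow : ∀ i j : Fin 3, i < j → ((nb : GL (Fin 3) K) : Matrix (Fin 3) (Fin 3) K) i j = 0 := by
    intro i j hij; rw [hnb]; fin_cases i <;> fin_cases j <;> simp at hij ⊢
  have hdiag : ∀ i : Fin 3, ((nb : GL (Fin 3) K) : Matrix (Fin 3) (Fin 3) K) i i = 1 := by
    intro i; rw [hnb]; fin_cases i <;> simp
  have hw : weylLongU σ hJ * weylLongU σ hJ = 1 := weylLongU_mul_weylLongU σ hJ
  have hnbN : nb ∈ ((borelTriple σ J hJ).N).map (MulAut.conj (weylLongU σ hJ)).toMonoidHom := by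
    refine ⟨weylLongU σ hJ * nb * weylLongU σ hJ, ?_, ?_⟩
    · rw [borelTriple_N]; exact weylLongU_mul_mul_weylLongU_mem_unipotentU σ hJ hlow hdiag
    · change weylLongU σ hJ * (weylLongU σ hJ * nb * weylLongU σ hJ) * (weylLongU σ hJ)⁻¹ = nb
      rw [inv_eq_of_mul_eq_one_right hw, ← mul_assoc, ← mul_assoc, hw, one_mul, mul_assoc, hw, mul_one]
  -- `b = n̄⁻¹ g`: its first column is `(a, 0, 0)`
  have hinv : ∀ i j, (((nb⁻¹ : ↥(unitaryGroupOfForm σ J)) : GL (Fin 3) K) : Matrix (Fin 3) (Fin 3) K) i j =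
      σ (((nb : GL (Fin 3) K) : Matrix (Fin 3) (Fin 3) K) (Fin.rev j) (Fin.rev i)) := fun i j => coe_inv_apply_eq σ hJ nb i j
  have hmul : ∀ i j, (((nb⁻¹ * g : ↥(unitaryGroupOfForm σ J)) : GL (Fin 3) K) : Matrix (Fin 3) (Fin 3) K) i j =
      ∑ k, (((nb⁻¹ : ↥(unitaryGroupOfForm σ J)) : GL (Fin 3) K) : Matrix (Fin 3) (Fin 3) K) i k * ((g : GL (Fin 3) K) : Matrix (Fin 3) (Fin 3) K) k j := by
    intro i j; rw [Subgroup.coe_mul, Units.val_mul, Matrix.mul_apply]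
  have r0 : Fin.rev (0 : Fin 3) = 2 := rfl
  have r1 : Fin.rev (1 : Fin 3) = 1 := rfl
  have r2 : Fin.rev (2 : Fin 3) = 0 := rfl
  have hb10 : (((nb⁻¹ * g : ↥(unitaryGroupOfForm σ J)) : GL (Fin 3) K) : Matrix (Fin 3) (Fin 3) K) 1 0 = 0 := by
    rw [hmul, Fin.sum_univ_three, hinv, hinv, hinv, r0, r1, r2, e21, e11, e01, map_one, map_zero, hσp, ← ha, ← hb₁, ← hc]
    field_simp
    ring
  have hb20 : (((nb⁻¹ * g : ↥(unitaryGroupOfForm σ J)) : GL (Fin 3) K) : Matrix (Fin 3) (Fin 3) K) 2 0 = 0 := by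
    rw [hmul, Fin.sum_univ_three, hinv, hinv, hinv, r0, r1, r2, e20, e10, e00, map_one, map_neg, hσ, hσq, hp, ← ha, ← hb₁, ← hc]
    field_simp
    linear_combination hiso
  -- `b₂₁ = 0` by the `(0,1)` Hermitian relation
  have hb21 : (((nb⁻¹ * g : ↥(unitaryGroupOfForm σ J)) : GL (Fin 3) K) : Matrix (Fin 3) (Fin 3) K) 2 1 = 0 := by
    have hb00 : (((nb⁻¹ * g : ↥(unitaryGroupOfForm σ J)) : GL (Fin 3) K) : Matrix (Fin 3) (Fin 3) K) 0 0 = a := by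
      rw [hmul, Fin.sum_univ_three, hinv, hinv, hinv, r0, r1, r2, e22, e12, e02, map_one, map_zero, ← ha, ← hb₁, ← hc]; ring
    have r := sum_rel_of_mem σ hJ (nb⁻¹ * g) 0 1
    simp only [Fin.sum_univ_three, r0, r1, r2, hb10, hb20, hb00, map_zero, zero_mul, add_zero] at r
    have r' : σ a * (((nb⁻¹ * g : ↥(unitaryGroupOfForm σ J)) : GL (Fin 3) K) : Matrix (Fin 3) (Fin 3) K) 2 1 = 0 := by
      simpa using r
    exact (mul_eq_zero.1 r').resolve_left hσa0
  refine ⟨nb, nb⁻¹ * g, hnbI, hnbN, Subgroup.mul_mem _ (Subgroup.inv_mem _ hnbI) hg, ?_, by rw [mul_inv_cancel_left]⟩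
  rw [mem_borelU_iff]
  intro i j hij
  fin_cases i <;> fin_cases j
  all_goals first | exact absurd hij (by decide) | exact hb10 | exact hb20 | exact hb21

include hJ hσ hvσ hvϖ hJg in
-- adapted from ★ `K2E3IwahoriLevelNFactorisation.exists_nbar_mul_torus_mul_unipotent_of_mem_inf_pow` (K2E3-p37 (g0))
/-- **THE IWAHORI FACTORISATION OF `Jg`, elementwise**: every `g ∈ Jg` is `n̄ · m · n` with `n̄ ∈ Jg ∩ N̄`, `m ∈ Jg ∩ T`, `n ∈ Jg ∩ N` (`T = (borelTriple σ J hJ).M`,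
`N = (borelTriple σ J hJ).N`, `N̄ = N.map (conj w)`): §3 `g = n̄ b`, then `b = proj b · ((proj b)⁻¹ b)` (★ `ParabolicTriple.proj_inv_mul_mem`) with `proj b = diag(bᵢᵢ)` integral
(★ `val_proj_borelTriple`), hence in `Jg` (§2 `mem_of_diagonal`).  Valid for EVERY exponent matrix with `e i i = 0`, the anti-transpose symmetry and the N̄-side in `𝔭`; no
concavity needed. [cite: BruhatTits1972, (4.4.3)–(4.4.4), §6.4] [cite: Casselman1995, Prop. 1.4.4] [cite: Roche1998, §2–§3] [cite: Tits1979, §3.7] -/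
theorem exists_nbar_mul_torus_mul_unipotent_of_mem (he0 : ∀ i, e i i = 0) (hsym : ∀ i j, e (Fin.rev j) (Fin.rev i) = e i j)
    (h10 : 1 ≤ e 1 0) (h20 : 1 ≤ e 2 0) {g : ↥(unitaryGroupOfForm σ J)} (hg : g ∈ Jg) :
    ∃ nb m n : ↥(unitaryGroupOfForm σ J),
      nb ∈ Jg ∧ nb ∈ ((borelTriple σ J hJ).N).map (MulAut.conj (weylLongU σ hJ)).toMonoidHom ∧
      m ∈ Jg ∧ m ∈ (borelTriple σ J hJ).M ∧
      n ∈ Jg ∧ n ∈ (borelTriple σ J hJ).N ∧ g = nb * m * n := by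
  obtain ⟨nb, b, hnbI, hnbN, hbI, hbB, hg'⟩ := exists_lowerU_mul_borel_of_mem σ hJ hσ hvσ hvϖ e Jg hJg he0 hsym h10 h20 hg
  have hbP : b ∈ (borelTriple σ J hJ).P := by rw [borelTriple_P]; exact hbB
  set m : ↥(unitaryGroupOfForm σ J) := (((borelTriple σ J hJ).proj ⟨b, hbP⟩ : ↥(borelTriple σ J hJ).M) : ↥(unitaryGroupOfForm σ J)) with hm
  have hmM : m ∈ (borelTriple σ J hJ).M := ((borelTriple σ J hJ).proj ⟨b, hbP⟩).2
  have hnN : m⁻¹ * b ∈ (borelTriple σ J hJ).N := (borelTriple σ J hJ).proj_inv_mul_mem ⟨b, hbP⟩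
  -- `m = diag(bᵢᵢ)` is integral and diagonal: `m ∈ Jg`
  have hbK0 : b ∈ (glInt 3 K).subgroupOf (unitaryGroupOfForm σ J) := le_glInt_subgroupOf σ hJ hvσ hvϖ e Jg hJg hbI
  have hbint := (mem_glInt_subgroupOf_iff σ hJ hvσ b).1 hbK0
  have hmval : ((m : GL (Fin 3) K) : Matrix (Fin 3) (Fin 3) K) = Matrix.diagonal fun i => ((b : GL (Fin 3) K) : Matrix (Fin 3) (Fin 3) K) i i :=
    val_proj_borelTriple σ J hJ ⟨b, hbP⟩
  have hmK0 : m ∈ (glInt 3 K).subgroupOf (unitaryGroupOfForm σ J) := by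
    rw [mem_glInt_subgroupOf_iff σ hJ hvσ, hmval]
    intro i j
    rw [Matrix.diagonal_apply]
    split_ifs with hij
    · exact hbint i i
    · rw [map_zero]; exact zero_le
  have hmI : m ∈ Jg := mem_of_diagonal σ hJ hvσ e Jg hJg he0 hmK0 hmval
  refine ⟨nb, m, m⁻¹ * b, hnbI, hnbN, hmI, hmM, Subgroup.mul_mem _ (Subgroup.inv_mem _ hmI) hbI, hnN, ?_⟩
  rw [hg', mul_assoc, mul_inv_cancel_left]

include hJ hσ hvσ hvϖ hJg in
/-- **THE IWAHORI FACTORISATION OF `Jg` as a set identity**: `Jg = (Jg ∩ N̄)·(Jg ∩ T)·(Jg ∩ N)` — the `factorization` field of ★ `ParabolicTriple.IwahoriDatum` for the Borel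
triple of `U(σ, Φ₃)(K)` at ANY concave-exponent level group whose N̄-side lies in `𝔭` (★ `K2E3IwahoriLevelNFactorisation.coe_inf_pow_eq_mul` is the one-depth instance, ★
`K2E3IwahoriFactorisationThree.coe_inf_eq_mul` is `n = 1`). [cite: Casselman1995, Prop. 1.4.4] [cite: BruhatTits1972, (4.4.4), §6.4] [cite: Roche1998, §2–§3] -/
theorem coe_eq_mul (he0 : ∀ i, e i i = 0) (hsym : ∀ i j, e (Fin.rev j) (Fin.rev i) = e i j) (h10 : 1 ≤ e 1 0) (h20 : 1 ≤ e 2 0) :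
    ((Jg : Subgroup ↥(unitaryGroupOfForm σ J)) : Set ↥(unitaryGroupOfForm σ J)) =
      ((Jg ⊓ ((borelTriple σ J hJ).N).map (MulAut.conj (weylLongU σ hJ)).toMonoidHom : Subgroup ↥(unitaryGroupOfForm σ J)) :
          Set ↥(unitaryGroupOfForm σ J)) *
        ((Jg ⊓ (borelTriple σ J hJ).M : Subgroup ↥(unitaryGroupOfForm σ J)) : Set ↥(unitaryGroupOfForm σ J)) *
        ((Jg ⊓ (borelTriple σ J hJ).N : Subgroup ↥(unitaryGroupOfForm σ J)) : Set ↥(unitaryGroupOfForm σ J)) := by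
  ext g
  constructor
  · intro hg
    obtain ⟨nb, m, n', hnbI, hnbN, hmI, hmM, hnI, hnN, rfl⟩ :=
      exists_nbar_mul_torus_mul_unipotent_of_mem σ hJ hσ hvσ hvϖ e Jg hJg he0 hsym h10 h20 hg
    exact Set.mul_mem_mul (Set.mul_mem_mul (Subgroup.mem_inf.2 ⟨hnbI, hnbN⟩) (Subgroup.mem_inf.2 ⟨hmI, hmM⟩)) (Subgroup.mem_inf.2 ⟨hnI, hnN⟩)
  · rintro ⟨_, ⟨nb, hnb, m, hm, rfl⟩, n', hn', rfl⟩
    exact Subgroup.mul_mem _ (Subgroup.mul_mem _ (Subgroup.mem_inf.1 hnb).1 (Subgroup.mem_inf.1 hm).1) (Subgroup.mem_inf.1 hn').1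

end Letters

/-! ## §4 The one-depth `J_n = K₀ ⊓ g_n K₀ g_n⁻¹` of ★ p861548 is the instance `e = ![![0,0,0],![n,0,0],![n,n,0]]` -/

include hJ hvσ hvϖ in
/-- **★ `K2E3IwahoriLevelNFactorisation`'s `J_n` satisfies the letter `hJg`** with the exponent matrix `![![0, 0, 0], ![n, 0, 0], ![n, n, 0]]` (`(r, s, r', s') = (0, 0, n, n)`):
its test `mem_glInt_inf_conj_glInt_pow_iff` (integral `∧ |k₂₀|, |k₂₁|, |k₁₀| ≤ |ϖ|ⁿ`) is `TEST_e`.  So every §2–§3 statement specialises to ★ p861548's, and the two bricks agree.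
[cite: BruhatTits1972, (4.4.3)–(4.4.4)] [cite: Roche1998, §2–§3] -/
theorem mem_levelN_iff_test {n : ℕ} (gn : GL (Fin 3) K) (hgn : (gn : Matrix (Fin 3) (Fin 3) K) = Matrix.diagonal ![(1 : K), 1, ϖ ^ n])
    (k : ↥(unitaryGroupOfForm σ J)) :
    k ∈ (glInt 3 K).subgroupOf (unitaryGroupOfForm σ J) ⊓ ((glInt 3 K).map (MulAut.conj gn).toMonoidHom).subgroupOf (unitaryGroupOfForm σ J) ↔
      ∀ i j, Valued.v (((k : GL (Fin 3) K) : Matrix (Fin 3) (Fin 3) K) i j) ≤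
        Valued.v ϖ ^ (![![0, 0, 0], ![n, 0, 0], ![n, n, 0]] : Fin 3 → Fin 3 → ℕ) i j := by
  rw [K2E3IwahoriLevelNFactorisation.mem_glInt_inf_conj_glInt_pow_iff σ hJ hvσ hvϖ gn hgn k,
    test_twoDepth_iff σ (v_uniformiser_le_one hvϖ) 0 0 n n k]
  simp only [pow_zero]
  constructor
  · rintro ⟨hint, h20, h21, h10⟩
    exact ⟨hint, hint 0 1, hint 1 2, hint 0 2, h10, h21, h20⟩
  · rintro ⟨hint, -, -, -, h10, h21, h20⟩
    exact ⟨hint, h20, h21, h10⟩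

end Summit.HodgeConjecture.HodgeConjecture.Cruxes.H413.K2E3IwahoriTwoDepthFactorisation

end
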